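import Summits.QuantumFields.QCD.Theses.WilsonQuarkChessboard
import Summits.QuantumFields.QCD.Theses.QuarksAsStableAction
import Literature.MathematicalPhysics.QuantumFieldTheory.MassGapToLatticeClustering
import HarnessLib.Audit

/-!
# Line `registered` (birth skeleton, gen 2) for the crux `MassiveBridge` (item stmt-QuantumFields-17577)

Route `WilsonQuarkChessboard` (sub-problem QCD), crux decl
`Summit.QuantumFields.QCD.Theses.WilsonQuarkChessboard.MassiveBridge`:

  `QuarkChessboard → FlatCellOptimal → ∀ N_f ∈ {2,3}, ∃ M₀ ≥ 0, ∃ reg, reg.HasMassScaling ∧ ∀ m > M₀,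
     ∃ z shift T, IsQCDAlong (reg.scheme m z shift) T ∧ T.IsNontrivial glue ∧ T.IsNonGaussian glue ∧
       (∀ f ≠ g, T.IsNontrivial (pseudoRe f g)) ∧ ∃ Δ > 0, T.HasMassGap Δ ∧ (reg.scheme m z shift).HasLatticeMassGap Δ`.

## Gen 2 (lead `prover-line-stmt-QuantumFields-17577-0`, 2026-08-17): RESHAPE of the registered birth skeleton

Gen 1 (`planner-skel-stmt-QuantumFields-17577-0`, sha 65697275…) cut the crux into `stub_dominationUV` (UV existence
above a threshold), `stub_heavyQuarkLatticeGap` (heavy-quark LATTICE gap law) and `stub_gapInheritance`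
(`IsQCDAlong sch T → sch.HasLatticeMassGap Δ → ∃ Δ' ∈ (0, Δ], T.HasMassGap Δ'`).  The third stub is MISSTATED as
typed: it is the `∃Δ'`-kernel of the shared support item `GradientFlowSpecies.GapTransfer` (stmt-QuantumFields-8923),
whose hypothesis `QCDScheme.HasLatticeMassGap` — per-PAIR constants `∃ C` chosen before `∀ᶠ k`, LOCAL lattice
observables, LATTICE times — says nothing uniform about the `O(a_k⁻⁴)` translates entering one smeared species
field and therefore does not pass to the `k → ∞` limit (RobustYangMillsHandover leads' audit `GapTransfer-AUDIT.md`,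
standing disproof `Cruxes/RobustYangMillsHandover/Disproof.lean` §13; `FINDING-a3-spectral-infrastructure.md` M4:
"pair-uniformity … physics, not infrastructure; no formal route").  What DOES transfer is proved in the tree:
`Literature…MassGapFromLatticeClustering` (`IsQCDAlong.hasMassGap_of_hasSpeciesCSClustering`: eventual, `ε`-slack
Cauchy–Schwarz clustering of the smeared SPECIES correlators on finite families of slab-ordered real product data
⇒ `T.HasMassGap Δ`), with converse `Literature…MassGapToLatticeClustering`
(`IsQCDAlong.hasSpeciesCSClustering_iff_hasMassGap`: along a QCD scheme the species clustering IS the continuum gap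
clause).  Gen 2 therefore

* DISCHARGES `stub_gapInheritance` by the Literature theorem (no stub: the transfer is no longer owed);
* RE-CUTS `stub_heavyQuarkLatticeGap` into the two infrared laws the composition actually consumes, both stated
  for regularisations carrying FULL continuum data above the offset (the composition has them; the stronger
  hypothesis makes each law weaker than its gen-1 parent, `latticeGapLaw_of_heavyQuarkLatticeGap`):
  - `stub_latticeGapLaw : LatticeGapLawStmt` — the summit's lattice clause: above some `M₁ ≥ M₀` every tuple has
    `∃ Δ > 0, (reg.scheme m 0 0).HasLatticeMassGap Δ`.  By the offset shift `m_crit ↦ m_crit + a_k M₀/Z_m(k)` this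
    is implied by the shared open crux `GradientFlowSpecies.MassiveLatticeGap` (stmt-QuantumFields-8922) — reduction
    to be landed as a helper (`--supports`), whence this stub is that item's debt;
  - `stub_speciesClusteringLaw : SpeciesClusteringLawStmt` — above some `M₂ ≥ M₀`, for every tuple and EVERY
    data-carrying species renormalisation (`IsQCDAlong (reg.scheme m z shift) T` — the guard is load-bearing: the
    `ε`-slack of `HasSpeciesCSClustering` is absolute, so a `k`-dependent rescaling `z ↦ s_k z` with `s_k → ∞`
    breaks the clause; along convergent data it is EQUIVALENT to `∃ Δ > 0, T.HasMassGap Δ`,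
    `speciesClusteringLaw_iff_continuumGapLaw`) the lattice theory clusters the smeared species correlators in
    Cauchy–Schwarz form at some rate `Δ > 0` (`QCDScheme.HasSpeciesCSClustering`, Lüscher's positive transfer
    matrix with spectral gap `Δ a_k`).  NEW as a statement (no existing item); same physics as the lattice law.
* keeps `stub_dominationUV : DominationUVStmt` VERBATIM (registered).  Its offset-free form is the shared UV item
  `RenormalisedVafaWitten.DynamicalQuarkContinuum` (stmt-QuantumFields-8695); `ThresholdContinuum ↔ (offset-free)` by
  `M₀ = 0` / the `m_crit` shift — reduction to be landed as a helper, whence this stub is that item's debt modulo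
  the idle hypotheses `C ∧ K`.

`MassiveBridge_of : DominationUVStmt → LatticeGapLawStmt → SpeciesClusteringLawStmt → MassiveBridge` is
kernel-checked: threshold `max M₁ M₂ ≥ M₀ ≥ 0`; for a tuple above it the data give `(z, shift, T)`, the lattice law
`Δ₁` (moved to the data's scheme: the clause reads only `β_k, m_f(k), L_k, a_k`, `hasLatticeMassGap_scheme_iff`),
the clustering law `Δ₂` at the data's own `(z, shift, T)`, the Literature transfer `T.HasMassGap Δ₂`, and both gaps
are weakened to `min Δ₁ Δ₂` (`hasLatticeMassGap_mono`, `hasMassGap_anti`).  `massiveBridge_of_stubs : MassiveBridge`.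
Sorries: 3, all in `stub_*` (gen 1: 3; one discharged, one split).  §4 keeps the gen-1 statements and composition
(`MassiveBridge_of_gen1`) as sorry-free documentation of the reshape's direction.

## Gen 2.1 (same lead, after wave 1): every open stub identified with shared items by LANDED reductions (§5, prepared as a comment until the farm builds the landed modules)

* `stub_dominationUV ⇔ (FlatCellOptimal → RenormalisedVafaWitten.DynamicalQuarkContinuum)` — stmt-QuantumFields-8695, C proved and
  idle (`Theorems/WilsonQuarkChessboardMassiveBridgeStubDominationUV.lean`, p148760; worker 1);
* `stub_latticeGapLaw ⇔ GradientFlowSpecies.MassiveLatticeGap` — stmt-QuantumFields-8922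
  (`Theorems/WilsonQuarkChessboardMassiveBridgeStubLatticeGapLaw.lean`, p148355; worker 2);
* `stub_speciesClusteringLaw ⇔` its continuum-gap form `⇔` its offset-free form, and `⇐ 8922 ∧ GradientFlowSpecies.GapTransfer (8923)`
  (`Theorems/WilsonQuarkChessboardMassiveBridgeStubSpeciesClusteringLaw.lean`, p148819; lead) — NEW as a statement, no filed item;
* composition by name: `massiveBridge_of_sharedLaws` ((K → 8695) → 8922 → law₀ → MassiveBridge) and `massiveBridge_of_items`
  (8695 → 8922 → 8923 → MassiveBridge) (`Theorems/WilsonQuarkChessboardMassiveBridgeOfSharedLaws.lean`, p149234; lead).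
So the line is ALIVE with three open-problem stubs, two of which are filed items elsewhere; the third is promote-stub material.

## Gen 2.2 (continuation lead `prover-line-stmt-QuantumFields-17577-c1-0`, 2026-08-17): the crux AS A WHOLE is a shared item

The consequent of `MassiveBridge` is, character for character, the shared item stmt-QuantumFields-8794
`QuarksAsStableAction.ThresholdQCD` (= `HeavyThresholdYMBridge.ThresholdQCD`, the TARGET of that route): Lean agrees
definitionally, `MassiveBridge ↔ (QuarkChessboard → FlatCellOptimal → ThresholdQCD)` is `Iff.rfl` (§6; landed with the
C-discharged form `MassiveBridge ↔ (FlatCellOptimal → ThresholdQCD)`, `massiveBridge_of_thresholdQCD`,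
`thresholdQCD_of_massiveBridge` in `Theorems/WilsonQuarkChessboardMassiveBridgeThresholdQCD.lean`, p151841).  So modulo the
idle hypothesis K the crux is EXACTLY item 8794 (constructive massive QCD with a full-spectrum gap above an unpinned
offset), and the three stubs below are a refinement of that one debt (`thresholdQCD_of_stubs`, §6).  Stubs unchanged
(registered sha of gen 2.1 superseded by this file's); no worker wave this cycle — every open stub is delegated to an
existing open-problem item (wave-1 verdicts of lead 0: stub-blocked 8695 / stub-blocked 8922 / promote-stub).

## Negative knowledge honoured (read 2026-08-17T07Z)
* `ledger crux ls stmt-QuantumFields-17577`: no `Disproof.lean`, no dead line, no idea card; evidence = planner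
  `Sketch.lean`, refuter crux-attack `MassiveBridgeCruxAttack.lean` / `EVIDENCE.md` (crux SURVIVES as an honest
  open-problem bridge; C proved, K numerically robust ⇒ the vacuity channel `¬K → MassiveBridge` is closed; no junk
  witness: vacuum fails `IsNontrivial glue`, `z ≡ 0` / junk-0 partition functions / heavy-bare-mass decoupling fail
  the `pseudoRe f g` clause).
* `ledger negatives --problem QuantumFields`: no bespoke admissibility predicate is introduced (RobustYangMillsRG
  14958, MultibosonLatticeGap 9599); every stub is over the Statement's vocabulary plus the Literature clause
  `QCDScheme.HasSpeciesCSClustering`.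
* The unguarded clause `∀ z shift, HasSpeciesCSClustering (reg.scheme m z shift) Δ` (used by sibling skeletons) is
  NOT adopted: it is rescaling-fragile (above); only data-carrying `(z, shift)` are quantified.
-/

noncomputable section

namespace Summit.QuantumFields.QCD.Cruxes.MassiveBridge.Birth

open scoped BigOperators Topology Classical
open MeasureTheory Filter
open Literature.MathematicalPhysics.QuantumFieldTheory
open Summit.QuantumFields.QCD.Theses.WilsonQuarkChessboard

/-! ## §0 Currency -/

/-- **Dynamical-quark continuum data of `reg` above the flavour-blind threshold `M₀`** (gen-1 currency, kept for
the record of the reshape): for every tuple `m` with all `m_f > M₀` there are species renormalisations `z, shift`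
and OS data `T` with `IsQCDAlong (reg.scheme m z shift) T` whose flavour-CHANGING pseudoscalars `Re ψ̄_f iγ₅ ψ_g`,
`f ≠ g`, are not c-numbers. [folklore] -/
def DynamicalDataAbove (Nf : ℕ) (reg : QCDRegularisation Nf) (M₀ : ℝ) : Prop :=
  ∀ m : Fin Nf → ℝ, (∀ f, M₀ < m f) →
    ∃ (z shift : QCDField Nf → ℕ → ℝ) (T : OSData (QCDField Nf) 4),
      IsQCDAlong (reg.scheme m z shift) T ∧
        ∀ f g : Fin Nf, f ≠ g → T.IsNontrivial (QCDField.pseudoRe f g)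

/-- **Full continuum data of `reg` above `M₀`**: as `DynamicalDataAbove`, with non-trivial and non-Gaussian
glue — verbatim the body of the crux with its gap clause deleted. [folklore] -/
def ContinuumDataAbove (Nf : ℕ) (reg : QCDRegularisation Nf) (M₀ : ℝ) : Prop :=
  ∀ m : Fin Nf → ℝ, (∀ f, M₀ < m f) →
    ∃ (z shift : QCDField Nf → ℕ → ℝ) (T : OSData (QCDField Nf) 4),
      IsQCDAlong (reg.scheme m z shift) T ∧ T.IsNontrivial QCDField.glue ∧
        T.IsNonGaussian QCDField.glue ∧
          ∀ f g : Fin Nf, f ≠ g → T.IsNontrivial (QCDField.pseudoRe f g)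

/-- Full continuum data contain the dynamical-quark data. [folklore] -/
theorem ContinuumDataAbove.dynamical {Nf : ℕ} {reg : QCDRegularisation Nf} {M₀ : ℝ}
    (h : ContinuumDataAbove Nf reg M₀) : DynamicalDataAbove Nf reg M₀ := by
  intro m hm
  obtain ⟨z, shift, T, hqcd, -, -, hps⟩ := h m hm
  exact ⟨z, shift, T, hqcd, hps⟩

/-- Continuum data above a threshold are continuum data above every larger threshold. [folklore] -/
theorem ContinuumDataAbove.mono {Nf : ℕ} {reg : QCDRegularisation Nf} {M₀ M₁ : ℝ}
    (h : ContinuumDataAbove Nf reg M₀) (hle : M₀ ≤ M₁) : ContinuumDataAbove Nf reg M₁ :=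
  fun m hm => h m fun f => hle.trans_lt (hm f)

/-- **Threshold continuum** (the UV half in threshold form): for `N_f ∈ {2,3}` an offset `M₀ ≥ 0` and a
mass-independent regularisation with leading-log mass scaling carrying full continuum data above `M₀`.  Its
offset-free form (`∀ m > 0`) is the shared item `RenormalisedVafaWitten.DynamicalQuarkContinuum`
(stmt-QuantumFields-8695), equivalent by the shift `m_crit(k) ↦ m_crit(k) + a_k M₀ / Z_m(k)`. [folklore] -/
def ThresholdContinuum : Prop :=
  ∀ Nf : ℕ, Nf = 2 ∨ Nf = 3 → ∃ M₀ : ℝ, 0 ≤ M₀ ∧ ∃ reg : QCDRegularisation Nf,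
    reg.HasMassScaling ∧ ContinuumDataAbove Nf reg M₀

/-! ## §1 The stub statements -/

/-- **(S1) Domination ⇒ ultraviolet existence above a threshold** (the route's node DominationUV; open-problem;
registered gen 1, UNCHANGED).  The quark chessboard C (proved @ b37869be232f) and the flat-cell optimum K — together
the pathwise, local, sign-free bound `|∏_f det_AP D_W[U, m_f]| ≤ exp(−∑_f ∑_c φ_c(U, m_f))`, `φ_c ≥ φ_flat`, for
`U(3) ⊃ SU(3)` fields at bare masses near `0` — are the large-field fermion input from which a Bałaban-type block
renormalisation group with dynamical Wilson quarks yields, for `N_f = 2, 3`, ONE mass-independent regularisation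
with `HasMassScaling` and an unpinned offset `M₀ ≥ 0` such that every tuple above `M₀` has OS data tied to lattice
QCD along the SEQUENCE, with non-trivial non-Gaussian glue and non-decoupled flavoured pseudoscalars.  No gap is
claimed.  Why it might fail: no block RG with a dynamical non-abelian field + Wilson quarks exists in `d = 4`; RG
steps need local determinant RATIOS while C bounds from above only; the `N_f = 3` sign normalisation.  Status gen 2:
its offset-free form is the shared UV item stmt-QuantumFields-8695 (C, K idle).  Size: open-problem.
[cite: Balaban1989LargeFieldII] [cite: JaffeWitten2000, §5] -/
def DominationUVStmt : Prop :=
  QuarkChessboard → FlatCellOptimal → ThresholdContinuum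

/-- **(S2, gen 1 — retired by the gen-2 split; kept for the record) Heavy-quark LATTICE gap law** with the
dynamical-quark data as hypothesis. [cite: JaffeWitten2000, §5] -/
def HeavyQuarkLatticeGapStmt : Prop :=
  ∀ Nf : ℕ, Nf = 2 ∨ Nf = 3 → ∀ (reg : QCDRegularisation Nf) (M₀ : ℝ), reg.HasMassScaling → 0 ≤ M₀ →
    DynamicalDataAbove Nf reg M₀ →
      ∃ M₁ : ℝ, M₀ ≤ M₁ ∧ ∀ m : Fin Nf → ℝ, (∀ f, M₁ < m f) →
        ∃ Δ : ℝ, 0 < Δ ∧ (reg.scheme m 0 0).HasLatticeMassGap Δ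

/-- **(S3, gen 1 — retired: MISSTATED as typed; kept for the record) Continuum gap inheritance from the per-pair
lattice clause.**  The `∃Δ'`-kernel of `GradientFlowSpecies.GapTransfer` (stmt-QuantumFields-8923): per-pair
constants of `HasLatticeMassGap` do not pass to the limit; replaced by the proved species-level transfer
`IsQCDAlong.hasMassGap_of_hasSpeciesCSClustering`. [cite: GlimmJaffe1987, §6.1 Thm. 6.1.3] -/
def GapInheritanceStmt : Prop :=
  ∀ (Nf : ℕ) (sch : QCDScheme Nf) (T : OSData (QCDField Nf) 4) (Δ : ℝ),
    IsQCDAlong sch T → 0 < Δ → sch.HasLatticeMassGap Δ →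
      ∃ Δ' : ℝ, 0 < Δ' ∧ Δ' ≤ Δ ∧ T.HasMassGap Δ'

/-- **(S2a) Lattice gap law above a threshold** (gen 2; the summit's LATTICE clause, open-problem).  For
`N_f ∈ {2,3}`, every regularisation `reg` with `HasMassScaling` carrying FULL continuum data above some `M₀ ≥ 0`
(`IsQCDAlong` + non-trivial non-Gaussian glue + non-decoupled `pseudoRe f g` for every tuple above `M₀`: this pins
`m_crit(k)` to a bounded renormalised offset of the honest critical line) has a possibly LARGER threshold `M₁ ≥ M₀`
above which every tuple has a uniform full-spectrum lattice gap `(reg.scheme m 0 0).HasLatticeMassGap Δ`,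
`Δ = Δ(m) > 0` (all gauge-invariant local lattice QCD observables, all tori `S ≥ L_k`, uniformly in the volume,
eventually in `k`).  By the offset shift it is implied by the shared crux `GradientFlowSpecies.MassiveLatticeGap`
(stmt-QuantumFields-8922).  Why plausibly true: above `M₁` the lattice theories are `SU(3)` Yang–Mills with heavy
dynamical quarks, gapped uniformly in spacing and volume (Yang–Mills gap + decoupling).  Why it might fail: it
contains the weak-coupling lattice Yang–Mills gap along an asymptotically scaling sequence; `N_f = 3` signed
weights in the volume-uniform constants.  Size: open-problem. [cite: JaffeWitten2000, §5] [cite: OsterwalderSeiler1978, §§2–4] -/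
def LatticeGapLawStmt : Prop :=
  ∀ Nf : ℕ, Nf = 2 ∨ Nf = 3 → ∀ (reg : QCDRegularisation Nf) (M₀ : ℝ), reg.HasMassScaling → 0 ≤ M₀ →
    ContinuumDataAbove Nf reg M₀ →
      ∃ M₁ : ℝ, M₀ ≤ M₁ ∧ ∀ m : Fin Nf → ℝ, (∀ f, M₁ < m f) →
        ∃ Δ : ℝ, 0 < Δ ∧ (reg.scheme m 0 0).HasLatticeMassGap Δ

/-- **(S2b) Species clustering law above a threshold** (gen 2; the lattice statement the CONTINUUM gap clause is
read off from, open-problem).  For `N_f ∈ {2,3}`, every regularisation with `HasMassScaling` and full continuum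
data above `M₀ ≥ 0` has a threshold `M₂ ≥ M₀` such that for every tuple above `M₂` and every DATA-CARRYING species
renormalisation — `(z, shift, T)` with `IsQCDAlong (reg.scheme m z shift) T` — the lattice theories cluster the
smeared species correlators in the Cauchy–Schwarz (transfer-matrix) form at some rate `Δ > 0` in physical units,
`(reg.scheme m z shift).HasSpeciesCSClustering Δ`: eventually in `k`, with `ε`-slack,
`|⟨F̂Ω, (𝕋^{t/a_k} − |Ω⟩⟨Ω|) ĜΩ⟩| ≤ e^{−Δt} ‖F̂Ω‖ ‖ĜΩ‖ + ε` on finite families of slab-ordered real product data.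
This is what Lüscher's positive transfer matrix with spectral gap `≥ Δ a_k` on the tori `(2L_k+1)⁴` delivers; the
guard `IsQCDAlong` supplies the equicontinuity (Banach–Steinhaus on slab-supported factor spaces) that kills the
`O(a_k)` time-mismatch and the `(−1)^F` finite-time corrections inside the slack.  Along the guard it is EQUIVALENT
to `∃ Δ > 0, T.HasMassGap Δ` (`speciesClusteringLaw_iff_continuumGapLaw`).  Why it might fail: the same Yang–Mills
input as (S2a); in addition the species channels must see the gap uniformly in `k` with the data's own
normalisations.  Size: open-problem. [cite: Luscher1977] [cite: OsterwalderSeiler1978, §§2–4] [cite: JaffeWitten2000, §5] -/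
def SpeciesClusteringLawStmt : Prop :=
  ∀ Nf : ℕ, Nf = 2 ∨ Nf = 3 → ∀ (reg : QCDRegularisation Nf) (M₀ : ℝ), reg.HasMassScaling → 0 ≤ M₀ →
    ContinuumDataAbove Nf reg M₀ →
      ∃ M₂ : ℝ, M₀ ≤ M₂ ∧ ∀ m : Fin Nf → ℝ, (∀ f, M₂ < m f) →
        ∀ (z shift : QCDField Nf → ℕ → ℝ) (T : OSData (QCDField Nf) 4),
          IsQCDAlong (reg.scheme m z shift) T →
            ∃ Δ : ℝ, 0 < Δ ∧ (reg.scheme m z shift).HasSpeciesCSClustering Δ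

/-- **(S2b′) The continuum-gap form of (S2b)**: same quantifiers, conclusion `∃ Δ > 0, T.HasMassGap Δ`.  Not a stub;
equivalent to (S2b) along the guard (`speciesClusteringLaw_iff_continuumGapLaw`). [cite: JaffeWitten2000, §5] -/
def ContinuumGapLawStmt : Prop :=
  ∀ Nf : ℕ, Nf = 2 ∨ Nf = 3 → ∀ (reg : QCDRegularisation Nf) (M₀ : ℝ), reg.HasMassScaling → 0 ≤ M₀ →
    ContinuumDataAbove Nf reg M₀ →
      ∃ M₂ : ℝ, M₀ ≤ M₂ ∧ ∀ m : Fin Nf → ℝ, (∀ f, M₂ < m f) →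
        ∀ (z shift : QCDField Nf → ℕ → ℝ) (T : OSData (QCDField Nf) 4),
          IsQCDAlong (reg.scheme m z shift) T → ∃ Δ : ℝ, 0 < Δ ∧ T.HasMassGap Δ

/-! ## §2 The registered stubs (the ONLY `sorry`s of this file) -/

/-- (S1) domination ⇒ UV existence above a threshold — open-problem (registered gen 1, unchanged). -/
theorem stub_dominationUV : DominationUVStmt := by
  sorry

/-- (S2a) lattice gap law above a threshold — open-problem (gen 2; debt of stmt-QuantumFields-8922). -/
theorem stub_latticeGapLaw : LatticeGapLawStmt := by
  sorry

/-- (S2b) species clustering law above a threshold — open-problem (gen 2; new statement). -/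
theorem stub_speciesClusteringLaw : SpeciesClusteringLawStmt := by
  sorry

/-! ## §3 Composition (kernel-checked; no `sorry` below this line) -/

/-- The lattice gap clause of a regularisation's scheme does not read the species renormalisations `z, shift`
(only `β_k, m_f(k), L_k, a_k`): definitional. [folklore] -/
theorem hasLatticeMassGap_scheme_iff {Nf : ℕ} (reg : QCDRegularisation Nf) (m : Fin Nf → ℝ)
    (z shift : QCDField Nf → ℕ → ℝ) (Δ : ℝ) :
    (reg.scheme m z shift).HasLatticeMassGap Δ ↔ (reg.scheme m 0 0).HasLatticeMassGap Δ :=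
  Iff.rfl

/-- **Monotonicity of the uniform lattice gap in the rate**: a lattice gap `Δ` is a lattice gap `Δ' ≤ Δ`
(the constant is replaced by `max C 0`; `a_k n ≥ 0`). [folklore] -/
theorem hasLatticeMassGap_mono {Nf : ℕ} (sch : QCDScheme Nf) {Δ Δ' : ℝ}
    (h : sch.HasLatticeMassGap Δ) (hle : Δ' ≤ Δ) : sch.HasLatticeMassGap Δ' := by
  intro R R' A B
  obtain ⟨C, hC⟩ := h R R' A B
  refine ⟨max C 0, ?_⟩
  filter_upwards [hC] with k hk S hS n hn
  have h1 := hk S hS n hn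
  have han : 0 ≤ sch.a k * (n : ℝ) := mul_nonneg (sch.a_pos k).le (Nat.cast_nonneg n)
  have hexp : Real.exp (-(Δ * (sch.a k * n))) ≤ Real.exp (-(Δ' * (sch.a k * n))) :=
    Real.exp_le_exp.2 (by nlinarith)
  exact h1.trans ((mul_le_mul_of_nonneg_right (le_max_left C 0) (Real.exp_pos _).le).trans
    (mul_le_mul_of_nonneg_left hexp (le_max_right C 0)))

/-- **Monotonicity of the continuum gap in the rate**: `T.HasMassGap Δ` gives `T.HasMassGap Δ'` for `Δ' ≤ Δ`
(constant `max C 0`; `t ≥ 0`). [folklore] -/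
theorem hasMassGap_anti {Nf : ℕ} (T : OSData (QCDField Nf) 4) {Δ Δ' : ℝ}
    (h : T.HasMassGap Δ) (hle : Δ' ≤ Δ) : T.HasMassGap Δ' := by
  intro n m k k' F G hF hG
  obtain ⟨C, hC⟩ := h n m k k' F G hF hG
  refine ⟨max C 0, fun t ht H hH => ?_⟩
  have h1 := hC t ht H hH
  have hexp : Real.exp (-Δ * t) ≤ Real.exp (-Δ' * t) := Real.exp_le_exp.2 (by nlinarith)
  exact h1.trans ((mul_le_mul_of_nonneg_right (le_max_left C 0) (Real.exp_pos _).le).trans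
    (mul_le_mul_of_nonneg_left hexp (le_max_right C 0)))

/-- **The crux from the three stubs** (concludes `MassiveBridge` BY NAME).  The UV stub gives the offset `M₀`, the
regularisation and its full continuum data; the lattice law gives `M₁ ≥ M₀`, the clustering law `M₂ ≥ M₀`; above
`max M₁ M₂` the data supply `(z, shift, T)`, the lattice law a rate `Δ₁` (moved to the data's own scheme by
`hasLatticeMassGap_scheme_iff`), the clustering law a rate `Δ₂` at the data's own `(z, shift, T)`, the Literature
transfer `IsQCDAlong.hasMassGap_of_hasSpeciesCSClustering` the continuum gap `Δ₂`, and both clauses are weakened to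
the common rate `min Δ₁ Δ₂`. -/
theorem MassiveBridge_of :
    DominationUVStmt → LatticeGapLawStmt → SpeciesClusteringLawStmt → MassiveBridge := by
  intro hUV hL hS
  unfold MassiveBridge
  intro hC hK Nf hNf
  obtain ⟨M₀, hM₀, reg, hms, hdata⟩ := hUV hC hK Nf hNf
  obtain ⟨M₁, hM₀₁, hgap⟩ := hL Nf hNf reg M₀ hms hM₀ hdata
  obtain ⟨M₂, hM₀₂, hcs⟩ := hS Nf hNf reg M₀ hms hM₀ hdata
  refine ⟨max M₁ M₂, hM₀.trans (hM₀₁.trans (le_max_left _ _)), reg, hms, fun m hm => ?_⟩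
  have hm₁ : ∀ f, M₁ < m f := fun f => (le_max_left M₁ M₂).trans_lt (hm f)
  have hm₂ : ∀ f, M₂ < m f := fun f => (le_max_right M₁ M₂).trans_lt (hm f)
  have hm₀ : ∀ f, M₀ < m f := fun f => hM₀₁.trans_lt (hm₁ f)
  obtain ⟨z, shift, T, hqcd, hglue, hng, hps⟩ := hdata m hm₀
  obtain ⟨Δ₁, hΔ₁, hlat⟩ := hgap m hm₁
  obtain ⟨Δ₂, hΔ₂, hclus⟩ := hcs m hm₂ z shift T hqcd
  have hlat' : (reg.scheme m z shift).HasLatticeMassGap Δ₁ :=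
    (hasLatticeMassGap_scheme_iff reg m z shift Δ₁).2 hlat
  have hTgap : T.HasMassGap Δ₂ := hqcd.hasMassGap_of_hasSpeciesCSClustering hclus
  exact ⟨z, shift, T, hqcd, hglue, hng, hps, min Δ₁ Δ₂, lt_min hΔ₁ hΔ₂,
    hasMassGap_anti T hTgap (min_le_right _ _), hasLatticeMassGap_mono _ hlat' (min_le_left _ _)⟩

/-- The crux along this skeleton, from the registered stubs (sorries only inside `stub_*`). -/
theorem massiveBridge_of_stubs : MassiveBridge :=
  MassiveBridge_of stub_dominationUV stub_latticeGapLaw stub_speciesClusteringLaw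

/-! ## §4 Sanity links (sorry-free; documentation of the reshape) -/

/-- The gen-2 lattice law is WEAKER than its gen-1 parent (stronger hypothesis: full data contain the dynamical
data). [folklore] -/
theorem latticeGapLaw_of_heavyQuarkLatticeGap (h : HeavyQuarkLatticeGapStmt) : LatticeGapLawStmt :=
  fun Nf hNf reg M₀ hms hM₀ hdata => h Nf hNf reg M₀ hms hM₀ hdata.dynamical

/-- **(S2b) ⇔ (S2b′)**: along the guard `IsQCDAlong`, species Cauchy–Schwarz clustering at rate `Δ` IS the
continuum gap clause `T.HasMassGap Δ` (Literature `IsQCDAlong.hasSpeciesCSClustering_iff_hasMassGap`). [cite: JaffeWitten2000, §5] -/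
theorem speciesClusteringLaw_iff_continuumGapLaw : SpeciesClusteringLawStmt ↔ ContinuumGapLawStmt := by
  constructor
  · intro h Nf hNf reg M₀ hms hM₀ hdata
    obtain ⟨M₂, hM₀₂, hm⟩ := h Nf hNf reg M₀ hms hM₀ hdata
    refine ⟨M₂, hM₀₂, fun m hmm z shift T hqcd => ?_⟩
    obtain ⟨Δ, hΔ, hcs⟩ := hm m hmm z shift T hqcd
    exact ⟨Δ, hΔ, hqcd.hasMassGap_of_hasSpeciesCSClustering hcs⟩
  · intro h Nf hNf reg M₀ hms hM₀ hdata
    obtain ⟨M₂, hM₀₂, hm⟩ := h Nf hNf reg M₀ hms hM₀ hdata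
    refine ⟨M₂, hM₀₂, fun m hmm z shift T hqcd => ?_⟩
    obtain ⟨Δ, hΔ, hgap⟩ := hm m hmm z shift T hqcd
    exact ⟨Δ, hΔ, hqcd.hasSpeciesCSClustering_of_hasMassGap hgap⟩

/-- **Gen-1 composition, kept verbatim** (documents that the registered gen-1 cut also concludes the crux by name;
its third hypothesis is the retired, misstated `GapInheritanceStmt`). -/
theorem MassiveBridge_of_gen1 :
    DominationUVStmt → HeavyQuarkLatticeGapStmt → GapInheritanceStmt → MassiveBridge := by
  intro hUV hIR hT
  unfold MassiveBridge
  intro hC hK Nf hNf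
  obtain ⟨M₀, hM₀, reg, hms, hdata⟩ := hUV hC hK Nf hNf
  obtain ⟨M₁, hM₀₁, hgap⟩ := hIR Nf hNf reg M₀ hms hM₀ hdata.dynamical
  refine ⟨M₁, hM₀.trans hM₀₁, reg, hms, fun m hm => ?_⟩
  have hm₀ : ∀ f, M₀ < m f := fun f => hM₀₁.trans_lt (hm f)
  obtain ⟨z, shift, T, hqcd, hglue, hng, hps⟩ := hdata m hm₀
  obtain ⟨Δ, hΔ, hlat⟩ := hgap m hm
  have hlat' : (reg.scheme m z shift).HasLatticeMassGap Δ :=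
    (hasLatticeMassGap_scheme_iff reg m z shift Δ).2 hlat
  obtain ⟨Δ', hΔ', hle, hTgap⟩ := hT Nf (reg.scheme m z shift) T Δ hqcd hΔ hlat'
  exact ⟨z, shift, T, hqcd, hglue, hng, hps, Δ', hΔ', hTgap, hasLatticeMassGap_mono _ hlat' hle⟩

/-- **The discharged third stub, in the shape the composition needs**: along a QCD scheme, species clustering at a
positive rate gives a continuum gap at a rate in `(0, Δ]` (here `Δ' = Δ`, no loss) — the gen-1 `GapInheritanceStmt`
with its hypothesis `HasLatticeMassGap` replaced by `HasSpeciesCSClustering`. [cite: GlimmJaffe1987, §6.1 Thm. 6.1.3] -/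
theorem gapInheritance_species (Nf : ℕ) (sch : QCDScheme Nf) (T : OSData (QCDField Nf) 4) (Δ : ℝ)
    (hqcd : IsQCDAlong sch T) (hΔ : 0 < Δ) (hcs : sch.HasSpeciesCSClustering Δ) :
    ∃ Δ' : ℝ, 0 < Δ' ∧ Δ' ≤ Δ ∧ T.HasMassGap Δ' :=
  ⟨Δ, hΔ, le_rfl, hqcd.hasMassGap_of_hasSpeciesCSClustering hcs⟩

/- ## §5 (gen 2.1, PREPARED — elaborates in the lead's folder copy `work/MassiveBridge.lean` once the farm has built the four
landed modules `Theorems/WilsonQuarkChessboardMassiveBridge{StubDominationUV,StubLatticeGapLaw,StubSpeciesClusteringLaw,OfSharedLaws}`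
(imports to add then); kept here as a comment (comment markers defused as (doc)/(cod)) so that this published skeleton elaborates today.

(§) ## §5 The open stubs identified with shared items (gen 2.1: LANDED reductions, re-checked here by `Iff.rfl`
unfolding of this file's `def`s against the inlined statements of the Theorems files) (cod)

(doc) **S1 is the shared UV item modulo K** (landed p148760,
`Theorems/WilsonQuarkChessboardMassiveBridgeStubDominationUV.lean`): `DominationUVStmt ↔ (FlatCellOptimal →
RenormalisedVafaWitten.DynamicalQuarkContinuum)` (stmt-QuantumFields-8695; C is proved and idle). [cite: JaffeWitten2000, §5] (cod)
theorem stub_dominationUV_iff_item :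
    DominationUVStmt ↔
      (FlatCellOptimal → Summit.QuantumFields.QCD.Theses.RenormalisedVafaWitten.DynamicalQuarkContinuum) :=
  Summit.QuantumFields.QCD.Theorems.massiveBridge_dominationUV_iff_dynamicalQuarkContinuum

(doc) **S2a is the shared lattice gap law** (landed p148355,
`Theorems/WilsonQuarkChessboardMassiveBridgeStubLatticeGapLaw.lean`): `LatticeGapLawStmt ↔
GradientFlowSpecies.MassiveLatticeGap` (stmt-QuantumFields-8922). [cite: JaffeWitten2000, §5] (cod)
theorem stub_latticeGapLaw_iff_item :
    LatticeGapLawStmt ↔ Summit.QuantumFields.QCD.Theses.GradientFlowSpecies.MassiveLatticeGap :=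
  Summit.QuantumFields.QCD.Theorems.massiveBridge_latticeGapLaw_iff_massiveLatticeGap

(doc) **S2b follows from the shared items 8922 ∧ 8923** (landed p148819,
`Theorems/WilsonQuarkChessboardMassiveBridgeStubSpeciesClusteringLaw.lean`): the species clustering law is
implied by `GradientFlowSpecies.MassiveLatticeGap` together with `GradientFlowSpecies.GapTransfer` (as typed),
and it is the honest replacement of the latter's role. [cite: JaffeWitten2000, §5] (cod)
theorem stub_speciesClusteringLaw_of_items
    (hML : Summit.QuantumFields.QCD.Theses.GradientFlowSpecies.MassiveLatticeGap)
    (hGT : Summit.QuantumFields.QCD.Theses.GradientFlowSpecies.GapTransfer) : SpeciesClusteringLawStmt :=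
  Summit.QuantumFields.QCD.Theorems.massiveBridge_speciesClusteringLaw_of_massiveLatticeGap_of_gapTransfer
    hML hGT

(doc) **The crux is conditional on three filed items** (landed p149234,
`Theorems/WilsonQuarkChessboardMassiveBridgeOfSharedLaws.lean`, `massiveBridge_of_items`):
`DynamicalQuarkContinuum (8695) → MassiveLatticeGap (8922) → GapTransfer (8923) → MassiveBridge`; the in-skeleton
route is `MassiveBridge_of` fed with §5's identifications. [cite: JaffeWitten2000, §5] (cod)
theorem massiveBridge_of_items'
    (hUV : Summit.QuantumFields.QCD.Theses.RenormalisedVafaWitten.DynamicalQuarkContinuum)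
    (hML : Summit.QuantumFields.QCD.Theses.GradientFlowSpecies.MassiveLatticeGap)
    (hGT : Summit.QuantumFields.QCD.Theses.GradientFlowSpecies.GapTransfer) : MassiveBridge :=
  MassiveBridge_of (stub_dominationUV_iff_item.2 fun _ => hUV) (stub_latticeGapLaw_iff_item.2 hML)
    (stub_speciesClusteringLaw_of_items hML hGT)


-/

/-! ## §6 (gen 2.2) The crux as a whole is the shared item stmt-QuantumFields-8794 behind `C ∧ K` (sorry-free) -/

/-- **`MassiveBridge ↔ (C → K → ThresholdQCD)`, definitionally**: the crux's consequent is verbatim the shared item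
`QuarksAsStableAction.ThresholdQCD` (stmt-QuantumFields-8794).  Landed by name (p151841,
`Theorems/WilsonQuarkChessboardMassiveBridgeThresholdQCD.lean`, `massiveBridge_iff_imp_thresholdQCD`); repeated here so the
published skeleton carries it. [cite: JaffeWitten2000, §5] -/
theorem massiveBridge_iff_imp_thresholdQCD_skel :
    MassiveBridge ↔
      (QuarkChessboard → FlatCellOptimal → Summit.QuantumFields.QCD.Theses.QuarksAsStableAction.ThresholdQCD) :=
  Iff.rfl

/-- **Item 8794 ⇒ the crux** (both chessboard hypotheses idle). CONDITIONAL on item 8794. [cite: JaffeWitten2000, §5] -/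
theorem massiveBridge_of_thresholdQCD_skel
    (h : Summit.QuantumFields.QCD.Theses.QuarksAsStableAction.ThresholdQCD) : MassiveBridge :=
  fun _ _ => h

/-- **The three registered stubs, with C and K, discharge item 8794** (the skeleton's composition read as a proof of the
shared threshold item: this line, if it ever closes, closes crux r7 of `QuarksAsStableAction` and the target of
`HeavyThresholdYMBridge` as well). [cite: JaffeWitten2000, §5] -/
theorem thresholdQCD_of_stubs (hUV : DominationUVStmt) (hL : LatticeGapLawStmt) (hS : SpeciesClusteringLawStmt)
    (hC : QuarkChessboard) (hK : FlatCellOptimal) :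
    Summit.QuantumFields.QCD.Theses.QuarksAsStableAction.ThresholdQCD :=
  massiveBridge_iff_imp_thresholdQCD_skel.1 (MassiveBridge_of hUV hL hS) hC hK

end Summit.QuantumFields.QCD.Cruxes.MassiveBridge.Birth

end
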